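import Summits.CriticalPhenomena.PercolationContinuityZ3.Theorems.PercNearOneGluingNoHeavyLowerTailCubicThreePointTransitions
import Summits.CriticalPhenomena.PercolationContinuityZ3.Theorems.PercNearOneGluingNoHeavyLowerTailCubicThreePointBernsteinStep
import HarnessLib

/-!
# `NoHeavyLowerTail` (stmt-CriticalPhenomena-4575) — SHK3⁺ / 3PT-LB terminal-edge induction, part 3: the induction modulo the Bernstein step

Support file (prover prim-ineq-prove-2 gen 2; `--supports stmt-CriticalPhenomena-4575`), continuing `…CubicThreePointTransitions` and using the
algebra of `…CubicThreePointBernsteinStep`.  `shk3W D p K a b c` = SHK3⁺ `F(q,u₁,u₂,u₃,t) = (σ+t)(qt − e₂(u)) − e₃(u)` evaluated on the weighted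
three-point law (random edges `D`, weights `p`, forced edges `K`).  `StepHyp V` = the two Bernstein inequalities (B1),(B2) (`threeB₁, threeB₂ ≥ 0`
at the cells and the five apex transition masses) for every `(D, K, p, a, b, c, x ≠ m)` with `x` forced-joined to `a` — 0 violations in ttrl2's
exhaustive weighted census `bern4`, certificate OPEN.  THEOREM `shk3_of_stepHyp`: `StepHyp V → ∀ D K p ∈ [0,1] a b c, 0 ≤ F(law)` — i.e.
SHK3⁺ = 3PT-LB = Richards–Sahi `E₃ ≥ 0` on the pairwise separations, for bond percolation on every finite weighted graph, follows from (B1),(B2).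
Proof: strong induction on `|D|`; if some non-loop edge of `D` has an endpoint forced-joined to a terminal, peel it (`step_apex`: `PrW_split`, the
transition identities, the two induction hypotheses, `F_segment_nonneg_of_bernstein`; terminal symmetry `shk3W_swap12/13` moves the apex to `a`);
otherwise the terminals are frozen (`frozen_iff`) and the law is a unit vector, where `F = 0` (`shk3W_eq_zero_of_frozen`).
Memo: run/shared/lean/prim/prim-ineq-prove-2/MEMO-7-3PTLB-INDUCTION.md.
[cite: GladkovZimin2024HK, §4 (coordinate induction)]; [cite: Gladkov2024StrongFKG, Cor. 4.2 (quadratic part of F)]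
-/

noncomputable section

namespace Summit.CriticalPhenomena.PercolationContinuityZ3.Theorems

namespace CubicThreePointStep

open Finset SimpleGraph Literature.Probability.Percolation.DecisionTree

variable {V : Type*} [DecidableEq V]

/-! ### Terminal symmetries of the law -/

section Symmetry

variable (D : Finset (Sym2 V)) (p : Sym2 V → ℝ) (K : Finset (Sym2 V)) (a b c : V)

/-- SHK3⁺ evaluated on the weighted three-point law of `(a,b,c)` with forced edges `K`. [folklore] -/
def shk3W : ℝ :=
  F (PrW D p (evQ K a b c)) (PrW D p (evU₁ K a b c)) (PrW D p (evU₂ K a b c)) (PrW D p (evU₃ K a b c))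
    (PrW D p (evT K a b c))

/-- `abc` is symmetric under `a ↔ b`. [folklore] -/
theorem evT_swap12 : evT K b a c = evT K a b c := by
  ext S; simp only [mem_evT]
  exact ⟨fun ⟨h1, h2⟩ => ⟨h1.symm, h1.symm.trans h2⟩, fun ⟨h1, h2⟩ => ⟨h1.symm, h1.symm.trans h2⟩⟩
/-- `ab|c` is symmetric under `a ↔ b`. [folklore] -/
theorem evU₁_swap12 : evU₁ K b a c = evU₁ K a b c := by
  ext S; simp only [mem_evU₁]
  exact ⟨fun ⟨h1, h2⟩ => ⟨h1.symm, fun h => h2 (h1.trans h)⟩, fun ⟨h1, h2⟩ => ⟨h1.symm, fun h => h2 (h1.trans h)⟩⟩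
/-- `a ↔ b` exchanges `ac|b` and `bc|a`. [folklore] -/
theorem evU₂_swap12 : evU₂ K b a c = evU₃ K a b c := by
  ext S; simp only [mem_evU₂, mem_evU₃]
  exact ⟨fun ⟨h1, h2⟩ => ⟨h1, fun h => h2 h.symm⟩, fun ⟨h1, h2⟩ => ⟨h1, fun h => h2 h.symm⟩⟩
/-- `a ↔ b` exchanges `bc|a` and `ac|b`. [folklore] -/
theorem evU₃_swap12 : evU₃ K b a c = evU₂ K a b c := by
  ext S; simp only [mem_evU₂, mem_evU₃]
  exact ⟨fun ⟨h1, h2⟩ => ⟨h1, fun h => h2 h.symm⟩, fun ⟨h1, h2⟩ => ⟨h1, fun h => h2 h.symm⟩⟩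
/-- `a|b|c` is symmetric under `a ↔ b`. [folklore] -/
theorem evQ_swap12 : evQ K b a c = evQ K a b c := by
  ext S; simp only [mem_evQ]
  exact ⟨fun ⟨h1, h2, h3⟩ => ⟨fun h => h1 h.symm, fun h => h3 h, fun h => h2 h⟩,
    fun ⟨h1, h2, h3⟩ => ⟨fun h => h1 h.symm, fun h => h3 h, fun h => h2 h⟩⟩
/-- `abc` is symmetric under `a ↔ c`. [folklore] -/
theorem evT_swap13 : evT K c b a = evT K a b c := by
  ext S; simp only [mem_evT]
  exact ⟨fun ⟨h1, h2⟩ => ⟨h2.symm.trans h1, h2.symm⟩, fun ⟨h1, h2⟩ => ⟨h2.symm.trans h1, h2.symm⟩⟩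
/-- `a ↔ c` exchanges `ab|c` and `bc|a`. [folklore] -/
theorem evU₁_swap13 : evU₁ K c b a = evU₃ K a b c := by
  ext S; simp only [mem_evU₁, mem_evU₃]
  exact ⟨fun ⟨h1, h2⟩ => ⟨h1.symm, fun h => h2 (h1.trans h.symm)⟩, fun ⟨h1, h2⟩ => ⟨h1.symm, fun h => h2 (h.symm.trans h1.symm)⟩⟩
/-- `ac|b` is symmetric under `a ↔ c`. [folklore] -/
theorem evU₂_swap13 : evU₂ K c b a = evU₂ K a b c := by
  ext S; simp only [mem_evU₂]
  exact ⟨fun ⟨h1, h2⟩ => ⟨h1.symm, fun h => h2 (h1.trans h)⟩, fun ⟨h1, h2⟩ => ⟨h1.symm, fun h => h2 (h1.trans h)⟩⟩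
/-- `a ↔ c` exchanges `bc|a` and `ab|c`. [folklore] -/
theorem evU₃_swap13 : evU₃ K c b a = evU₁ K a b c := by
  ext S; simp only [mem_evU₁, mem_evU₃]
  exact ⟨fun ⟨h1, h2⟩ => ⟨h1.symm, fun h => h2 (h.symm.trans h1.symm)⟩, fun ⟨h1, h2⟩ => ⟨h1.symm, fun h => h2 (h1.trans h.symm)⟩⟩
/-- `a|b|c` is symmetric under `a ↔ c`. [folklore] -/
theorem evQ_swap13 : evQ K c b a = evQ K a b c := by
  ext S; simp only [mem_evQ]
  exact ⟨fun ⟨h1, h2, h3⟩ => ⟨fun h => h3 h.symm, fun h => h2 h.symm, fun h => h1 h.symm⟩,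
    fun ⟨h1, h2, h3⟩ => ⟨fun h => h3 h.symm, fun h => h2 h.symm, fun h => h1 h.symm⟩⟩

/-- SHK3⁺ is symmetric in the terminals: swapping `a,b`. [folklore] -/
theorem shk3W_swap12 : shk3W D p K b a c = shk3W D p K a b c := by
  unfold shk3W
  rw [evT_swap12 K a b c, evU₁_swap12 K a b c, evU₂_swap12 K a b c, evU₃_swap12 K a b c, evQ_swap12 K a b c]
  simp only [F]
  ring

/-- SHK3⁺ is symmetric in the terminals: swapping `a,c`. [folklore] -/
theorem shk3W_swap13 : shk3W D p K c b a = shk3W D p K a b c := by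
  unfold shk3W
  rw [evT_swap13 K a b c, evU₁_swap13 K a b c, evU₂_swap13 K a b c, evU₃_swap13 K a b c, evQ_swap13 K a b c]
  simp only [F]
  ring

end Symmetry

/-! ### Frozen terminals: no random edge touches the forced clusters -/

section Frozen

variable {D K : Finset (Sym2 V)} {a : V}

/-- If no non-loop edge of `D` has an endpoint forced-joined to `a`, the open cluster of `a` is its forced cluster. [folklore] -/
theorem frozen_reach (hD : ∀ e ∈ D, ∀ y z : V, e = s(y, z) → y ≠ z → ¬ R K ∅ a y)
    {S : Finset (Sym2 V)} (hS : S ⊆ D) {y : V} (h : R K S a y) : R K ∅ a y := by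
  obtain ⟨w⟩ := h
  suffices key : ∀ {u v : V} (w' : (fromEdgeSet (↑(S ∪ K) : Set (Sym2 V))).Walk u v), R K ∅ a u → R K ∅ a v from
    key w (R_refl K ∅ a)
  intro u v w'
  induction w' with
  | nil => exact id
  | @cons u' v' w'' hadj _ ih =>
    intro hu
    refine ih ?_
    rw [fromEdgeSet_adj] at hadj
    obtain ⟨hmem, hne⟩ := hadj
    rw [Finset.coe_union, Set.mem_union, Finset.mem_coe, Finset.mem_coe] at hmem
    rcases hmem with hmem | hmem
    · exact absurd hu (hD _ (hS hmem) u' v' rfl hne)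
    · refine hu.trans (Adj.reachable ?_)
      rw [fromEdgeSet_adj]
      refine ⟨?_, hne⟩
      rw [Finset.coe_union, Set.mem_union, Finset.mem_coe, Finset.mem_coe]
      exact Or.inr hmem

/-- … hence the connection events of `a` do not depend on the configuration. [folklore] -/
theorem frozen_iff (hD : ∀ e ∈ D, ∀ y z : V, e = s(y, z) → y ≠ z → ¬ R K ∅ a y)
    {S : Finset (Sym2 V)} (hS : S ⊆ D) (y : V) : R K S a y ↔ R K ∅ a y :=
  ⟨frozen_reach hD hS, R_mono_config (Finset.empty_subset S)⟩

end Frozen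

/-- The five unit vectors are zeros of SHK3⁺ (deterministic laws). [folklore] -/
theorem F_unit_eq_zero :
    F (1 : ℝ) 0 0 0 0 = 0 ∧ F (0 : ℝ) 1 0 0 0 = 0 ∧ F (0 : ℝ) 0 1 0 0 = 0 ∧ F (0 : ℝ) 0 0 1 0 = 0 ∧
      F (0 : ℝ) 0 0 0 1 = 0 := by
  refine ⟨?_, ?_, ?_, ?_, ?_⟩ <;> norm_num [F]

/-- SHK3⁺ vanishes when the three terminals are frozen. [folklore] -/
theorem shk3W_eq_zero_of_frozen (D : Finset (Sym2 V)) (p : Sym2 V → ℝ) (K : Finset (Sym2 V)) (a b c : V)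
    (ha : ∀ e ∈ D, ∀ y z : V, e = s(y, z) → y ≠ z → ¬ R K ∅ a y)
    (hb : ∀ e ∈ D, ∀ y z : V, e = s(y, z) → y ≠ z → ¬ R K ∅ b y) :
    shk3W D p K a b c = 0 := by
  have eab : ∀ S, S ⊆ D → (R K S a b ↔ R K ∅ a b) := fun S hS => frozen_iff ha hS b
  have eac : ∀ S, S ⊆ D → (R K S a c ↔ R K ∅ a c) := fun S hS => frozen_iff ha hS c
  have ebc : ∀ S, S ⊆ D → (R K S b c ↔ R K ∅ b c) := fun S hS => frozen_iff hb hS c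
  obtain ⟨f1, f2, f3, f4, f5⟩ := F_unit_eq_zero
  unfold shk3W
  by_cases Pab : R K ∅ a b
  · by_cases Pac : R K ∅ a c
    · rw [PrW_eq_zero_of_forall D p (fun S hS h => h.1 ((eab S hS).2 Pab)),
        PrW_eq_zero_of_forall D p (fun S hS h => h.2 ((eac S hS).2 Pac)),
        PrW_eq_zero_of_forall D p (fun S hS h => h.2 ((eab S hS).2 Pab)),
        PrW_eq_zero_of_forall D p (fun S hS h => h.2 ((eab S hS).2 Pab)),
        PrW_eq_one_of_forall D p (fun S hS => show S ∈ evT K a b c from ⟨(eab S hS).2 Pab, (eac S hS).2 Pac⟩)]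
      exact f5
    · rw [PrW_eq_zero_of_forall D p (fun S hS h => h.1 ((eab S hS).2 Pab)),
        PrW_eq_one_of_forall D p (fun S hS => show S ∈ evU₁ K a b c from ⟨(eab S hS).2 Pab, fun h => Pac ((eac S hS).1 h)⟩),
        PrW_eq_zero_of_forall D p (fun S hS h => Pac ((eac S hS).1 h.1)),
        PrW_eq_zero_of_forall D p (fun S hS h => h.2 ((eab S hS).2 Pab)),
        PrW_eq_zero_of_forall D p (fun S hS h => Pac ((eac S hS).1 h.2))]
      exact f2
  · by_cases Pac : R K ∅ a c
    · have Pbc : ¬ R K ∅ b c := fun h => Pab (Pac.trans h.symm)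
      rw [PrW_eq_zero_of_forall D p (fun S hS h => h.2.1 ((eac S hS).2 Pac)),
        PrW_eq_zero_of_forall D p (fun S hS h => Pab ((eab S hS).1 h.1)),
        PrW_eq_one_of_forall D p (fun S hS => show S ∈ evU₂ K a b c from ⟨(eac S hS).2 Pac, fun h => Pab ((eab S hS).1 h)⟩),
        PrW_eq_zero_of_forall D p (fun S hS h => Pbc ((ebc S hS).1 h.1)),
        PrW_eq_zero_of_forall D p (fun S hS h => Pab ((eab S hS).1 h.1))]
      exact f3
    · by_cases Pbc : R K ∅ b c
      · rw [PrW_eq_zero_of_forall D p (fun S hS h => h.2.2 ((ebc S hS).2 Pbc)),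
          PrW_eq_zero_of_forall D p (fun S hS h => Pab ((eab S hS).1 h.1)),
          PrW_eq_zero_of_forall D p (fun S hS h => Pac ((eac S hS).1 h.1)),
          PrW_eq_one_of_forall D p (fun S hS => show S ∈ evU₃ K a b c from ⟨(ebc S hS).2 Pbc, fun h => Pab ((eab S hS).1 h)⟩),
          PrW_eq_zero_of_forall D p (fun S hS h => Pab ((eab S hS).1 h.1))]
        exact f4
      · rw [PrW_eq_one_of_forall D p (fun S hS => show S ∈ evQ K a b c from ⟨fun h => Pab ((eab S hS).1 h),
            fun h => Pac ((eac S hS).1 h), fun h => Pbc ((ebc S hS).1 h)⟩),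
          PrW_eq_zero_of_forall D p (fun S hS h => Pab ((eab S hS).1 h.1)),
          PrW_eq_zero_of_forall D p (fun S hS h => Pac ((eac S hS).1 h.1)),
          PrW_eq_zero_of_forall D p (fun S hS h => Pbc ((ebc S hS).1 h.1)),
          PrW_eq_zero_of_forall D p (fun S hS h => Pab ((eab S hS).1 h.1))]
        exact f1

/-! ### The step hypothesis (B1),(B2) and the induction -/

/-- **(B1),(B2) of the terminal-edge induction, as a hypothesis.**  For every random-edge set `D`, forced set `K`,
weights `p ∈ [0,1]`, terminals `a,b,c` and apex edge `{x,m}` (`x ≠ m`, `x` forced-joined to `a`), the two Bernstein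
coefficients `threeB₁, threeB₂` of SHK3⁺ — evaluated at the cells of the law with forced set `K` and at the five transition
masses `α₁ = P(a|b|c → ab|c)`, `α₂ = P(a|b|c → ac|b)`, `β₁ = P(ab|c → abc)`, `β₂ = P(ac|b → abc)`, `β₃ = P(bc|a → abc)`
towards the forced set `K ∪ {{x,m}}` — are nonnegative.  (0 violations in ttrl2's exhaustive weighted census `bern4`;
no certificate known.) [folklore] -/
def StepHyp (V : Type*) [DecidableEq V] : Prop :=
  ∀ (D K : Finset (Sym2 V)) (p : Sym2 V → ℝ), (∀ i, 0 ≤ p i) → (∀ i, p i ≤ 1) →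
    ∀ (a b c x m : V), x ≠ m → (∀ S : Finset (Sym2 V), R K S a x) →
      0 ≤ threeB₁ (PrW D p (evQ K a b c)) (PrW D p (evU₁ K a b c)) (PrW D p (evU₂ K a b c))
            (PrW D p (evU₃ K a b c)) (PrW D p (evT K a b c))
            (PrW D p (evQ K a b c ∩ evU₁ (insert s(x, m) K) a b c))
            (PrW D p (evQ K a b c ∩ evU₂ (insert s(x, m) K) a b c))
            (PrW D p (evU₁ K a b c ∩ evT (insert s(x, m) K) a b c))
            (PrW D p (evU₂ K a b c ∩ evT (insert s(x, m) K) a b c))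
            (PrW D p (evU₃ K a b c ∩ evT (insert s(x, m) K) a b c)) ∧
        0 ≤ threeB₂ (PrW D p (evQ K a b c)) (PrW D p (evU₁ K a b c)) (PrW D p (evU₂ K a b c))
            (PrW D p (evU₃ K a b c)) (PrW D p (evT K a b c))
            (PrW D p (evQ K a b c ∩ evU₁ (insert s(x, m) K) a b c))
            (PrW D p (evQ K a b c ∩ evU₂ (insert s(x, m) K) a b c))
            (PrW D p (evU₁ K a b c ∩ evT (insert s(x, m) K) a b c))
            (PrW D p (evU₂ K a b c ∩ evT (insert s(x, m) K) a b c))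
            (PrW D p (evU₃ K a b c ∩ evT (insert s(x, m) K) a b c))

section Induction

variable {p : Sym2 V → ℝ} (hp0 : ∀ i, 0 ≤ p i) (hp1 : ∀ i, p i ≤ 1)
include hp0 hp1

/-- **The apex step.**  If `e = {x,m} ∈ D`, `x ≠ m`, `x` is forced-joined to `a`, SHK3⁺ holds for `(D ∖ e, K)` and
`(D ∖ e, K ∪ {e})`, and (B1),(B2) hold, then SHK3⁺ holds for `(D, K)`. [folklore] -/
theorem step_apex (hstep : StepHyp V) {D K : Finset (Sym2 V)} {a b c x m : V} (hxm : x ≠ m)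
    (hax : ∀ S : Finset (Sym2 V), R K S a x) (he : s(x, m) ∈ D)
    (ih0 : 0 ≤ shk3W (D.erase s(x, m)) p K a b c) (ih1 : 0 ≤ shk3W (D.erase s(x, m)) p (insert s(x, m) K) a b c) :
    0 ≤ shk3W D p K a b c := by
  set e := s(x, m) with he_def
  set D' := D.erase e with hD'
  have heD' : e ∉ D' := Finset.notMem_erase e D
  have hD : D = insert e D' := (Finset.insert_erase he).symm
  -- the five cells of `(D, K)` as convex combinations of the two sections
  have sq : PrW D p (evQ K a b c) = (1 - p e) * PrW D' p (evQ K a b c) + p e * PrW D' p (evQ (insert e K) a b c) := by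
    rw [hD, PrW_split D' p heD', sect_evQ]
  have s1 : PrW D p (evU₁ K a b c) = (1 - p e) * PrW D' p (evU₁ K a b c) + p e * PrW D' p (evU₁ (insert e K) a b c) := by
    rw [hD, PrW_split D' p heD', sect_evU₁]
  have s2 : PrW D p (evU₂ K a b c) = (1 - p e) * PrW D' p (evU₂ K a b c) + p e * PrW D' p (evU₂ (insert e K) a b c) := by
    rw [hD, PrW_split D' p heD', sect_evU₂]
  have s3 : PrW D p (evU₃ K a b c) = (1 - p e) * PrW D' p (evU₃ K a b c) + p e * PrW D' p (evU₃ (insert e K) a b c) := by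
    rw [hD, PrW_split D' p heD', sect_evU₃]
  have sT : PrW D p (evT K a b c) = (1 - p e) * PrW D' p (evT K a b c) + p e * PrW D' p (evT (insert e K) a b c) := by
    rw [hD, PrW_split D' p heD', sect_evT]
  -- transitions
  have tQ := trans_Q D' p (K := K) (b := b) (c := c) (m := m) hax
  have t1 := trans_U₁ D' p (K := K) (a := a) (b := b) (c := c) (x := x) (m := m)
  have t2 := trans_U₂ D' p (K := K) (a := a) (b := b) (c := c) (x := x) (m := m)
  have t3 := trans_U₃ D' p (K := K) (b := b) (c := c) (m := m) hax
  have tT := trans_T D' p (K := K) (b := b) (c := c) (m := m) hax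
  -- abbreviations
  set q := PrW D' p (evQ K a b c)
  set u₁ := PrW D' p (evU₁ K a b c)
  set u₂ := PrW D' p (evU₂ K a b c)
  set u₃ := PrW D' p (evU₃ K a b c)
  set t := PrW D' p (evT K a b c)
  set α₁ := PrW D' p (evQ K a b c ∩ evU₁ (insert e K) a b c)
  set α₂ := PrW D' p (evQ K a b c ∩ evU₂ (insert e K) a b c)
  set β₁ := PrW D' p (evU₁ K a b c ∩ evT (insert e K) a b c)
  set β₂ := PrW D' p (evU₂ K a b c ∩ evT (insert e K) a b c)
  set β₃ := PrW D' p (evU₃ K a b c ∩ evT (insert e K) a b c)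
  have hq1 : PrW D' p (evQ (insert e K) a b c) = q - α₁ - α₂ := by linarith
  have hu1 : PrW D' p (evU₁ (insert e K) a b c) = u₁ + α₁ - β₁ := by linarith
  have hu2 : PrW D' p (evU₂ (insert e K) a b c) = u₂ + α₂ - β₂ := by linarith
  have hu3 : PrW D' p (evU₃ (insert e K) a b c) = u₃ - β₃ := by linarith
  have ht1 : PrW D' p (evT (insert e K) a b c) = t + β₁ + β₂ + β₃ := by linarith
  obtain ⟨hB1, hB2⟩ := hstep D' K p hp0 hp1 a b c x m hxm hax
  have h3 : 0 ≤ F (q - α₁ - α₂) (u₁ + α₁ - β₁) (u₂ + α₂ - β₂) (u₃ - β₃) (t + β₁ + β₂ + β₃) := by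
    have := ih1
    unfold shk3W at this
    rwa [hq1, hu1, hu2, hu3, ht1] at this
  have h0 : 0 ≤ F q u₁ u₂ u₃ t := ih0
  have key := F_segment_nonneg_of_bernstein h0 h3 hB1 hB2 (hp0 e) (hp1 e)
  unfold shk3W
  rw [sq, s1, s2, s3, sT, hq1, hu1, hu2, hu3, ht1]
  have e1 : (1 - p e) * q + p e * (q - α₁ - α₂) = q + p e * (-α₁ - α₂) := by ring
  have e2 : (1 - p e) * u₁ + p e * (u₁ + α₁ - β₁) = u₁ + p e * (α₁ - β₁) := by ring
  have e3 : (1 - p e) * u₂ + p e * (u₂ + α₂ - β₂) = u₂ + p e * (α₂ - β₂) := by ring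
  have e4 : (1 - p e) * u₃ + p e * (u₃ - β₃) = u₃ + p e * (-β₃) := by ring
  have e5 : (1 - p e) * t + p e * (t + β₁ + β₂ + β₃) = t + p e * (β₁ + β₂ + β₃) := by ring
  rw [e1, e2, e3, e4, e5]
  exact key

/-- **SHK3⁺ for every finite weighted graph, from the step hypothesis** (induction on the number of random edges;
base/frozen case `shk3W_eq_zero_of_frozen`, step `step_apex` at whichever terminal the chosen edge touches). [folklore] -/
theorem shk3W_nonneg_of_stepHyp (hstep : StepHyp V) :
    ∀ (n : ℕ) (D K : Finset (Sym2 V)) (a b c : V), D.card = n → 0 ≤ shk3W D p K a b c := by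
  intro n
  induction n using Nat.strong_induction_on with
  | _ n ih =>
  intro D K a b c hDn
  by_cases hex : ∃ e ∈ D, ∃ y z : V, e = s(y, z) ∧ y ≠ z ∧ (R K ∅ a y ∨ R K ∅ b y ∨ R K ∅ c y)
  · obtain ⟨e, heD, y, z, rfl, hyz, hreach⟩ := hex
    have hlt : (D.erase s(y, z)).card < n := by rw [← hDn]; exact Finset.card_erase_lt_of_mem heD
    have IH : ∀ (K' : Finset (Sym2 V)) (a' b' c' : V), 0 ≤ shk3W (D.erase s(y, z)) p K' a' b' c' :=
      fun K' a' b' c' => ih _ hlt _ K' a' b' c' rfl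
    rcases hreach with h | h | h
    · exact step_apex hp0 hp1 hstep hyz (fun S => R_mono_config (Finset.empty_subset S) h) heD (IH _ _ _ _) (IH _ _ _ _)
    · rw [← shk3W_swap12]
      exact step_apex hp0 hp1 hstep hyz (fun S => R_mono_config (Finset.empty_subset S) h) heD (IH _ _ _ _) (IH _ _ _ _)
    · rw [← shk3W_swap13]
      exact step_apex hp0 hp1 hstep hyz (fun S => R_mono_config (Finset.empty_subset S) h) heD (IH _ _ _ _) (IH _ _ _ _)
  · push Not at hex
    have ha : ∀ e ∈ D, ∀ y z : V, e = s(y, z) → y ≠ z → ¬ R K ∅ a y :=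
      fun e he y z hyz hne => (hex e he y z hyz hne).1
    have hb : ∀ e ∈ D, ∀ y z : V, e = s(y, z) → y ≠ z → ¬ R K ∅ b y :=
      fun e he y z hyz hne => (hex e he y z hyz hne).2.1
    rw [shk3W_eq_zero_of_frozen D p K a b c ha hb]

/-- **SHK3⁺ (= 3PT-LB = Richards–Sahi `E₃` on the pairwise separations) for bond percolation on every finite graph with
arbitrary edge weights, CONDITIONAL on the Bernstein step (B1),(B2)** — finitary form: for every random-edge set `D`, forced
set `K`, weights `p ∈ [0,1]` and terminals `a,b,c`,
`(σ+t)(q t − e₂(u)) ≥ e₃(u)` for the three-point connection law. [folklore] -/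
theorem shk3_of_stepHyp (hstep : StepHyp V) (D K : Finset (Sym2 V)) (a b c : V) :
    0 ≤ F (PrW D p (evQ K a b c)) (PrW D p (evU₁ K a b c)) (PrW D p (evU₂ K a b c)) (PrW D p (evU₃ K a b c))
      (PrW D p (evT K a b c)) :=
  shk3W_nonneg_of_stepHyp hp0 hp1 hstep D.card D K a b c rfl

end Induction


end CubicThreePointStep

end Summit.CriticalPhenomena.PercolationContinuityZ3.Theorems
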